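import Literature.NumberTheory.Sieve.CFCongruenceTransferBridge
import Literature.NumberTheory.Sieve.CFSemigroupEigenfunction
import HarnessLib

/-!
# A priori sup bounds for `𝓛^m_{s,q}` and the split bound for the Neumann-type series

Support file (all results proved) for the reduction of the named fact
`Literature.NumberTheory.Sieve.MageeOhWinter2019_uniformCounting` to [MageeOhWinter2019, Thm. 4].

* `sum_pair_weight_eq_cfTransfer_two`: `Σ_{a,a'} (denom(g_a g_{a'},x)²)^{-σ} F(g_a g_{a'} x) = (L_σ)² F (x)`
  (the positive single-letter operator `cfTransfer` of `CFSemigroupTransfer.lean`, applied twice);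
* `norm_cfCongL_iterate_le_gibbs`: **a priori sup bound** `‖𝓛^m_{s,q} g‖ ≤ 4^σ λ_σ^{2m} sup_I ‖g‖` on `I`
  (`σ = Re s ≥ 0`, `λ_σ = e^{P(σ)}`, Gibbs bound `L_σⁿ 1 ≤ 4^σ λ_σⁿ` of `CFSemigroupEigenfunction.lean`),
  uniform in `q` and in `Im s` — the head of the `m₀`-splitting;
* `norm_cfSeries_le_split`: **split bound** for `S g = Σ_m 𝓛^m g`:
  `sup_I ‖S g‖ ≤ sup_I‖g‖ Σ_{m<m₀} 4^σ λ_σ^{2m} + 2 B_{m₀} (Σ_m B_m)(M + L)` when the iterates obey (unweighted)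
  operator bounds `B_m` on piecewise Lipschitz functions (the tail is estimated termwise:
  `𝓛^{m₀+m} g = 𝓛^{m₀}(𝓛^m g)`);
* `norm_inverse_cfTwist_apply_le`: the resulting sup bound for `(1 - 𝓜_s)⁻¹ G` in terms of any sup
  bound for `S(vec G)` on `I`.

## References

* [MageeOhWinter2019] M. Magee, H. Oh, D. Winter, J. reine angew. Math. 753 (2019) 89–135, §3.4 (proof
  of Prop. 17), Lemma 23, Thm. 4.
-/

noncomputable section

open Set Filter
open scoped MatrixGroups Topology

namespace Literature.NumberTheory.Sieve

variable {A : Finset ℕ} (hA : ∀ a ∈ A, 1 ≤ a) (h2 : 2 ≤ A.card)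

/-! ### The positive operator dominating `𝓛_{s,q}` -/

section Positive

/-- `L_σ (L_σ F)(x) = Σ_{a'} ((x+a')²)^{-σ} Σ_a ((1/(x+a') + a)²)^{-σ} F(1/(1/(x+a') + a))`, and the pair data:
`denom(g_a g_{a'}, x) = (x + a')(1/(x+a') + a)`, `g_a g_{a'} x = 1/(1/(x+a') + a)`. [folklore] -/
theorem sum_pair_weight_eq_cfTransfer_two (σ : ℝ) (F : ℝ → ℝ) {x : ℝ} (hx : 0 ≤ x) (hA : ∀ a ∈ A, 1 ≤ a) :
    ∑ a ∈ A, ∑ a' ∈ A, ((cfDenom (cfGen a * cfGen a') x) ^ 2) ^ (-σ) * F (cfMoeb (cfGen a * cfGen a') x) =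
      (cfTransfer A σ)^[2] F x := by
  rw [Function.iterate_succ_apply', Function.iterate_one, cfTransfer, Finset.sum_comm]
  refine Finset.sum_congr rfl fun a' ha' => ?_
  rw [cfTransfer, Finset.mul_sum]
  refine Finset.sum_congr rfl fun a ha => ?_
  have ha'1 : (1 : ℝ) ≤ a' := by exact_mod_cast hA a' ha'
  have hxa' : 0 < x + a' := by linarith
  have hd : cfDenom (cfGen a * cfGen a') x = (x + a') * (1 / (x + a') + a) := by
    rw [cfDenom_pair]; field_simp; ring
  have hm : cfMoeb (cfGen a * cfGen a') x = 1 / (1 / (x + a') + a) := by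
    rw [cfMoeb_pair]; field_simp; ring
  rw [hd, hm, mul_pow, Real.mul_rpow (sq_nonneg _) (sq_nonneg _)]
  ring

include hA in
/-- **One-step domination by the positive operator:** if `‖G(g_a g_{a'} x)‖ ≤ M W(g_a g_{a'} x)` for all
pairs then `‖𝓛_{s,q} G (x)‖ ≤ M (L_σ² W)(x)` (`σ = Re s`, `x ≥ 0`). [cite: MageeOhWinter2019, Lemma 23] -/
theorem norm_cfCongL_le_cfTransfer_two {q : ℕ} [NeZero q] (s : ℂ) {G : ℝ → CfVec q} {W : ℝ → ℝ} {M : ℝ}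
    {x : ℝ} (hx : 0 ≤ x) (h : ∀ a ∈ A, ∀ a' ∈ A, ‖G (cfMoeb (cfGen a * cfGen a') x)‖ ≤ M * W (cfMoeb (cfGen a * cfGen a') x)) :
    ‖cfCongL A q s G x‖ ≤ M * (cfTransfer A s.re)^[2] W x := by
  refine (norm_cfCongL_le A s G hx).trans ?_
  rw [← sum_pair_weight_eq_cfTransfer_two s.re W hx hA, Finset.mul_sum]
  refine Finset.sum_le_sum fun a ha => ?_
  rw [Finset.mul_sum]
  refine Finset.sum_le_sum fun a' ha' => ?_
  have hw : 0 ≤ ((cfDenom (cfGen a * cfGen a') x) ^ 2) ^ (-s.re) := Real.rpow_nonneg (sq_nonneg _) _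
  calc ((cfDenom (cfGen a * cfGen a') x) ^ 2) ^ (-s.re) * ‖G (cfMoeb (cfGen a * cfGen a') x)‖
      ≤ ((cfDenom (cfGen a * cfGen a') x) ^ 2) ^ (-s.re) * (M * W (cfMoeb (cfGen a * cfGen a') x)) :=
        mul_le_mul_of_nonneg_left (h a ha a' ha') hw
    _ = M * (((cfDenom (cfGen a * cfGen a') x) ^ 2) ^ (-s.re) * W (cfMoeb (cfGen a * cfGen a') x)) := by ring

include hA in
/-- **A priori domination of the iterates:** for `g` with `‖g‖ ≤ M` on `I` and `m ≥ 1`,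
`‖𝓛^m g (x)‖ ≤ M (L_σ^{2m} 1)(x)` on `I_A`. [cite: MageeOhWinter2019, Lemma 23] -/
theorem norm_cfCongL_iterate_le_cfTransfer {q : ℕ} [NeZero q] (s : ℂ) {g : ℝ → CfVec q} {M : ℝ}
    (hgM : ∀ x ∈ cfI A, ‖g x‖ ≤ M) (m : ℕ) {x : ℝ} (hx : x ∈ cfIA A) :
    ‖(cfCongL A q s)^[m + 1] g x‖ ≤ M * (cfTransfer A s.re)^[2 * (m + 1)] (fun _ => 1) x := by
  induction m generalizing x with
  | zero =>
    rw [zero_add, Function.iterate_one, mul_one]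
    refine norm_cfCongL_le_cfTransfer_two hA s (W := fun y => ((cfTransfer A s.re)^[0] fun _ => (1 : ℝ)) y)
      (cfIA_subset_Icc A hx).1 fun a ha a' ha' => ?_
    rw [Function.iterate_zero, id_eq, mul_one]
    exact hgM _ (cfCyl_subset_cfI ha ha' (cfMoeb_pair_mem_cfCyl a a' hx))
  | succ m ih =>
    rw [show (cfCongL A q s)^[m + 1 + 1] g = cfCongL A q s ((cfCongL A q s)^[m + 1] g) from
      Function.iterate_succ_apply' _ _ _, show 2 * (m + 1 + 1) = 2 + 2 * (m + 1) by ring,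
      Function.iterate_add_apply (f := cfTransfer A s.re) (m := 2) (n := 2 * (m + 1))]
    refine norm_cfCongL_le_cfTransfer_two hA s (cfIA_subset_Icc A hx).1 fun a ha a' ha' => ih ?_
    exact cfCyl_subset_cfIA ha (hA a ha) (hA a' ha') (cfMoeb_pair_mem_cfCyl a a' hx)

include hA h2 in
/-- **A priori sup bound (Gibbs):** `‖𝓛^m_{s,q} g‖ ≤ 4^σ λ_σ^{2m} M` on `I` for all `m`, if `‖g‖ ≤ M` on `I`
(`σ = Re s ≥ 0`, `λ_σ = e^{P_A(σ)}`), uniformly in `q` and `Im s`. [cite: MageeOhWinter2019, Lemma 23] -/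
theorem norm_cfCongL_iterate_le_gibbs {q : ℕ} [NeZero q] {s : ℂ} (hs : 0 ≤ s.re) {g : ℝ → CfVec q} {M : ℝ}
    (hM : 0 ≤ M) (hgM : ∀ x ∈ cfI A, ‖g x‖ ≤ M) (m : ℕ) {x : ℝ} (hx : x ∈ cfI A) :
    ‖(cfCongL A q s)^[m] g x‖ ≤ (4 : ℝ) ^ s.re * cfEig A s.re ^ (2 * m) * M := by
  have hne := nonempty_of_two_le_card h2
  rcases m with _ | m
  · rw [Function.iterate_zero, id_eq, mul_zero, pow_zero, mul_one]
    refine (hgM x hx).trans ?_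
    have h4 : (1 : ℝ) ≤ (4 : ℝ) ^ s.re := Real.one_le_rpow (by norm_num) hs
    nlinarith
  · have hxA := cfI_subset_cfIA hA hx
    have hx01 := cfIA_subset_Icc A hxA
    refine (norm_cfCongL_iterate_le_cfTransfer hA s hgM m hxA).trans ?_
    have hmem := cfTransfer_iterate_one_div_mem hA hne hs (2 * (m + 1)) hx01
    have hlam : 0 < cfEig A s.re ^ (2 * (m + 1)) := pow_pos (cfEig_pos s.re) _
    have hW : (cfTransfer A s.re)^[2 * (m + 1)] (fun _ => 1) x ≤ (4 : ℝ) ^ s.re * cfEig A s.re ^ (2 * (m + 1)) := by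
      have := hmem.2; rwa [div_le_iff₀ hlam] at this
    calc M * (cfTransfer A s.re)^[2 * (m + 1)] (fun _ => 1) x ≤ M * ((4 : ℝ) ^ s.re * cfEig A s.re ^ (2 * (m + 1))) :=
          mul_le_mul_of_nonneg_left hW hM
      _ = _ := by ring

end Positive

/-! ### The split bound for `S g` -/

section Split

variable {q : ℕ} [NeZero q] {E' : Type*} [NormedAddCommGroup E'] [NormedSpace ℂ E']
variable {s : ℂ} (hs : 0 ≤ s.re) {B : ℕ → ℝ} (hB0 : ∀ m, 0 ≤ B m) (hBs : Summable B) (ℓ : CfVec q →L[ℂ] E')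
variable (hB : ∀ (m : ℕ) (g : ℝ → CfVec q) (M L : ℝ), 0 ≤ M → 0 ≤ L → (∀ x ∈ cfI A, ‖g x‖ ≤ M) →
      (∀ a ∈ A, ∀ a' ∈ A, ∀ x ∈ cfCyl A a a', ∀ y ∈ cfCyl A a a', ‖g x - g y‖ ≤ L * |x - y|) →
      (∀ x ∈ cfI A, ℓ (g x) = 0) →
      (∀ x ∈ cfI A, ‖(cfCongL A q s)^[m] g x‖ ≤ B m * (M + 1 * L)) ∧
      (∀ a ∈ A, ∀ a' ∈ A, ∀ x ∈ cfCyl A a a', ∀ y ∈ cfCyl A a a',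
        ‖(cfCongL A q s)^[m] g x - (cfCongL A q s)^[m] g y‖ ≤ (1 : ℝ)⁻¹ * (B m * (M + 1 * L)) * |x - y|))
variable (hℓ : ∀ (g : SL(2, ZMod q)) (v : CfVec q), ℓ v = 0 → ℓ (cfRep g v) = 0)
variable {g : ℝ → CfVec q} {M L : ℝ} (hM : 0 ≤ M) (hL : 0 ≤ L) (hgM : ∀ x ∈ cfI A, ‖g x‖ ≤ M)
  (hgL : ∀ a ∈ A, ∀ a' ∈ A, ∀ x ∈ cfCyl A a a', ∀ y ∈ cfCyl A a a', ‖g x - g y‖ ≤ L * |x - y|)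
  (hgℓ : ∀ x ∈ cfI A, ℓ (g x) = 0)

include hA hB hℓ hM hL hgM hgL hgℓ hB0 in
/-- **Termwise tail estimate:** `‖𝓛^{m₀+m} g (x)‖ ≤ 2 B_{m₀} B_m (M + L)` on `I`
(`𝓛^{m₀+m} g = 𝓛^{m₀}(𝓛^m g)` and `𝓛^m g` has piecewise Lipschitz data `(B_m(M+L), B_m(M+L))`).
[cite: MageeOhWinter2019, §3.4] -/
theorem norm_cfCongL_iterate_add_le (m₀ m : ℕ) {x : ℝ} (hx : x ∈ cfI A) :
    ‖(cfCongL A q s)^[m₀ + m] g x‖ ≤ 2 * B m₀ * B m * (M + L) := by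
  obtain ⟨h1, h2m⟩ := hB m g M L hM hL hgM hgL hgℓ
  simp only [one_mul, inv_one] at h1 h2m
  have hK : 0 ≤ B m * (M + L) := mul_nonneg (hB0 m) (add_nonneg hM hL)
  have hcon : ∀ y ∈ cfI A, ℓ ((cfCongL A q s)^[m] g y) = 0 := apply_cfCongL_iterate_eq_zero A hA ℓ hℓ s hgℓ m
  obtain ⟨k1, -⟩ := hB m₀ ((cfCongL A q s)^[m] g) (B m * (M + L)) (B m * (M + L)) hK hK h1 h2m hcon
  simp only [one_mul] at k1
  rw [Function.iterate_add_apply]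
  refine (k1 x hx).trans (le_of_eq (by ring))

include hA h2 hs hB hℓ hM hL hgM hgL hgℓ hB0 hBs in
/-- **The split bound for the series:** for every `m₀`,
`‖S g (x)‖ ≤ 4^σ M Σ_{m<m₀} λ_σ^{2m} + 2 B_{m₀} (Σ_m B_m)(M + L)` on `I` (head: a priori Gibbs bound;
tail: termwise by the operator bounds). [cite: MageeOhWinter2019, §3.4] -/
theorem norm_cfSeries_le_split (m₀ : ℕ) {x : ℝ} (hx : x ∈ cfI A) :
    ‖cfSeries A q s g x‖ ≤ (4 : ℝ) ^ s.re * M * ∑ m ∈ Finset.range m₀, cfEig A s.re ^ (2 * m) +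
      2 * B m₀ * (∑' m, B m) * (M + L) := by
  have hβ : ∀ (m : ℕ) (g : ℝ → CfVec q) (M L : ℝ), 0 ≤ M → 0 ≤ L → (∀ x ∈ cfI A, ‖g x‖ ≤ M) →
      (∀ a ∈ A, ∀ a' ∈ A, ∀ x ∈ cfCyl A a a', ∀ y ∈ cfCyl A a a', ‖g x - g y‖ ≤ L * |x - y|) →
      (∀ x ∈ cfI A, ℓ (g x) = 0) →
      (∀ x ∈ cfI A, ‖(cfCongL A q s)^[m] g x‖ ≤ B m * (M + 1 * L)) ∧
      (∀ a ∈ A, ∀ a' ∈ A, ∀ x ∈ cfCyl A a a', ∀ y ∈ cfCyl A a a',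
        ‖(cfCongL A q s)^[m] g x - (cfCongL A q s)^[m] g y‖ ≤ (1 : ℝ)⁻¹ * (B m * (M + 1 * L)) * |x - y|) := hB
  have hsum : Summable fun m => (cfCongL A q s)^[m] g x := summable_cfSeries A ℓ hBs hβ hM hL hgM hgL hgℓ hx
  rw [cfSeries, ← Summable.sum_add_tsum_nat_add m₀ hsum]
  refine (norm_add_le _ _).trans (add_le_add ?_ ?_)
  · refine (norm_sum_le _ _).trans ?_
    rw [Finset.mul_sum]
    refine Finset.sum_le_sum fun m _ => (norm_cfCongL_iterate_le_gibbs hA h2 hs hM hgM m hx).trans (le_of_eq (by ring))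
  · have hbd : ∀ m, ‖(cfCongL A q s)^[m + m₀] g x‖ ≤ 2 * B m₀ * (M + L) * B m := fun m => by
      rw [add_comm m m₀]
      exact (norm_cfCongL_iterate_add_le hA hB0 ℓ hB hℓ hM hL hgM hgL hgℓ m₀ m hx).trans (le_of_eq (by ring))
    have hs' : HasSum (fun m => 2 * B m₀ * (M + L) * B m) (2 * B m₀ * (M + L) * ∑' m, B m) :=
      (hBs.hasSum.mul_left _)
    refine (tsum_of_norm_bounded hs' hbd).trans (le_of_eq (by ring))

end Split

/-! ### Sup bound for the inverse from a sup bound for the series -/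

section InverseBound

variable {q : ℕ} [NeZero q] {E' : Type*} [NormedAddCommGroup E'] [NormedSpace ℂ E']
variable {s : ℂ} (hs : 0 ≤ s.re) {θ : ℝ} (hθ : 0 < θ) {β : ℕ → ℝ} (hβ0 : ∀ m, 0 ≤ β m) (hβs : Summable β)
variable (ℓ : CfVec q →L[ℂ] E') (hℓ : ∀ (g : SL(2, ZMod q)) (v : CfVec q), ℓ v = 0 → ℓ (cfRep g v) = 0)
variable (hβ : ∀ (m : ℕ) (g : ℝ → CfVec q) (M L : ℝ), 0 ≤ M → 0 ≤ L → (∀ x ∈ cfI A, ‖g x‖ ≤ M) →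
      (∀ a ∈ A, ∀ a' ∈ A, ∀ x ∈ cfCyl A a a', ∀ y ∈ cfCyl A a a', ‖g x - g y‖ ≤ L * |x - y|) →
      (∀ x ∈ cfI A, ℓ (g x) = 0) →
      (∀ x ∈ cfI A, ‖(cfCongL A q s)^[m] g x‖ ≤ β m * (M + θ * L)) ∧
      (∀ a ∈ A, ∀ a' ∈ A, ∀ x ∈ cfCyl A a a', ∀ y ∈ cfCyl A a a',
        ‖(cfCongL A q s)^[m] g x - (cfCongL A q s)^[m] g y‖ ≤ θ⁻¹ * (β m * (M + θ * L)) * |x - y|))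

include hA hs hθ hβ0 hβs hβ in
/-- **Sup bound for the preimage from a sup bound for the series.** If `G` is a family with
`|G_η| ≤ M_G`, `G_η` `L_G`-Lipschitz, `ℓ(vec G) = 0`, and the series `S(vec G)` is bounded by `M₁` on `I`,
then `|(cfPreimage G)_η(y)| ≤ M_G + #A² √|Γ_q| M_G + #A⁴ M₁`. [cite: MageeOhWinter2019, §3.4] -/
theorem norm_cfPreimage_apply_le (G : SL(2, ZMod q) → CfLip) {MG LG : ℝ} (hMG : 0 ≤ MG) (hLG : 0 ≤ LG)
    (hGM : ∀ η (y : Icc (0 : ℝ) 1), ‖G η y‖ ≤ MG)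
    (hGL : ∀ η (x y : Icc (0 : ℝ) 1), ‖G η x - G η y‖ ≤ LG * |(x : ℝ) - y|)
    (hGℓ : ∀ x ∈ Icc (0 : ℝ) 1, ℓ (cfVecOf G x) = 0) {M₁ : ℝ} (hM₁ : 0 ≤ M₁)
    (hS : ∀ x ∈ cfI A, ‖cfSeries A q s (cfVecOf G) x‖ ≤ M₁) (η : SL(2, ZMod q)) (y : Icc (0 : ℝ) 1) :
    ‖cfPreimage A q hA s G η y‖ ≤ MG + (A.card : ℝ) ^ 2 * (Real.sqrt (Fintype.card (SL(2, ZMod q))) * MG) +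
      (A.card : ℝ) ^ 4 * M₁ := by
  set CΓ : ℝ := Real.sqrt (Fintype.card (SL(2, ZMod q))) with hCΓ
  have hCΓ0 : 0 ≤ CΓ := Real.sqrt_nonneg _
  set g : ℝ → CfVec q := cfVecOf G with hg
  have hgM' : ∀ x, ‖g x‖ ≤ CΓ * MG := fun x => norm_cfVecOf_le G hMG hGM x
  have hgM : ∀ x ∈ cfI A, ‖g x‖ ≤ CΓ * MG := fun x _ => hgM' x
  have hgL01 : ∀ x ∈ Icc (0 : ℝ) 1, ∀ y ∈ Icc (0 : ℝ) 1, ‖g x - g y‖ ≤ CΓ * LG * |x - y| := fun x hx y hy => by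
    have := norm_cfVecOf_sub_le G hLG hGL hx hy; rw [← hCΓ] at this; linarith [this]
  have hgL : ∀ a ∈ A, ∀ a' ∈ A, ∀ x ∈ cfCyl A a a', ∀ y ∈ cfCyl A a a', ‖g x - g y‖ ≤ CΓ * LG * |x - y| :=
    fun a ha a' ha' x hx y hy => hgL01 x (cfI_subset_Icc hA (cfCyl_subset_cfI ha ha' hx)) y
      (cfI_subset_Icc hA (cfCyl_subset_cfI ha ha' hy))
  have hgℓ : ∀ x ∈ cfI A, ℓ (g x) = 0 := fun x hx => hGℓ x (cfI_subset_Icc hA hx)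
  have hM0 : 0 ≤ CΓ * MG := by positivity
  have hL0 : 0 ≤ CΓ * LG := by positivity
  set f : ℝ → CfVec q := cfSeries A q s g with hf
  -- any Lipschitz datum for `f` will do; take the one from `β`
  set L1 : ℝ := θ⁻¹ * ((∑' m, β m) * (CΓ * MG + θ * (CΓ * LG))) with hL1
  have hSβ0 : 0 ≤ ∑' m, β m := tsum_nonneg hβ0
  have hL10 : 0 ≤ L1 := by positivity
  have hfL : ∀ a ∈ A, ∀ a' ∈ A, ∀ x ∈ cfCyl A a a', ∀ y ∈ cfCyl A a a', ‖f x - f y‖ ≤ L1 * |x - y| :=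
    fun a ha a' ha' x hx y hy => norm_cfSeries_sub_le A ℓ hβs hβ hM0 hL0 hgM hgL hgℓ ha ha' hx hy
  have hmem : ∀ {x : ℝ}, x ∈ Icc (0 : ℝ) 1 → ∀ a ∈ A, ∀ a' ∈ A, cfMoeb (cfGen a * cfGen a') x ∈ Icc (0 : ℝ) 1 :=
    fun hx a ha a' ha' => cfIA_subset_Icc A (cfMoeb_pair_mem_cfIA ha (hA a ha) (hA a' ha') hx)
  have hLg := cfCongL_lipStep A hA hs (S := Icc (0 : ℝ) 1) (fun x hx => hx.1) (h := g) (Mh := CΓ * MG) (Lh := CΓ * LG)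
    (fun a ha a' ha' x hx => hgM' _)
    (fun a ha a' ha' x hx y hy => (hgL01 _ (hmem hx a ha a' ha') _ (hmem hy a ha a' ha')).trans
      (mul_le_mul_of_nonneg_left (abs_cfMoeb_pair_sub_le (hA a ha) (hA a' ha') hx.1 hy.1) hL0))
  have h2 : ‖cfTwist A hA q s G η y‖ ≤ (A.card : ℝ) ^ 2 * (CΓ * MG) := by
    have e : cfTwist A hA q s G η y = cfVecOf (cfTwist A hA q s G) y η := by rw [cfVecOf_apply, CfLip.extend_coe]
    rw [e, cfVecOf_cfTwist A q hA s G y.2]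
    exact (norm_apply_le_norm_cfVec _ _).trans (hLg.1 y y.2)
  have h3 : ‖cfExt2 A q s f η y‖ ≤ (A.card : ℝ) ^ 4 * M₁ := norm_cfExt2_apply_le hA hs hM₁ hL10 hS hfL η y
  calc ‖cfPreimage A q hA s G η y‖ = ‖G η y + cfTwist A hA q s G η y + cfExt2 A q s f η y‖ := rfl
    _ ≤ ‖G η y‖ + ‖cfTwist A hA q s G η y‖ + ‖cfExt2 A q s f η y‖ := norm_add₃_le
    _ ≤ MG + (A.card : ℝ) ^ 2 * (CΓ * MG) + (A.card : ℝ) ^ 4 * M₁ := add_le_add_three (hGM η y) h2 h3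

end InverseBound

end Literature.NumberTheory.Sieve
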